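import Literature.AnabelianGeometry.EtaleTheta.Discharge.Sec2LampModelCompletion

/-!
# The lamplighter model ([EtTh] §2 interface), part 4 (PROOF-ONLY): DISCRETE NORMALISERS — for every open subgroup
# `H ⊆ Π^tp_C = A × Q₀`, `N_{Π_C}(toHat H) = toHat(N_{Π^tp_C}(H))` (the shape of [EtTh] Lemma 2.17 (ii))

S. Mochizuki, *The étale theta function …*, Publ. RIMS **45** (2009) [MochizukiEtTh2009], §2, Lemma 2.17 (ii), PDF p. 58:
«`N_{Π̂}(H) = N_Π(H)`» [cite: MochizukiEtTh2009, Lem 2.17(ii) p.58].  abc-iut cell, block F, seat abc-iut-f-142 (row F-0606,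
INSTANCE form).  PROOF-ONLY (0 definitions apart from the abbreviation-free helper `conjF`, a plain function term).
THE ARGUMENT (elementary, no input from Lemma 2.17 (i)): let `g = (b, y) ∈ A × Q̂` normalise `toHat(H)`, `H` open.  `H` contains
every `(1, (m, 0))` with `m` trivial below a level `N₀` and position-wise eventually constant; conjugating by `y = (μ, a)` gives
the family `j ↦ μ_n(j) m_n(j − a_n) μ_n(j)⁻¹`, which must again be position-wise eventually constant.  (i) If the (coherent)
rotation part `a ∈ Ẑ` is not an integer it escapes every integer position for large `n`; planting the alternating lamp
`μ_n(0)⁻¹ d_n μ_n(0)` (`d_n = (0 1)` for even `n`, `1` for odd `n`) at position `−a_n` yields a legal test family whose conjugate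
reads `d_n` at position `0` — contradiction; so `a = k ∈ ℤ`.  (ii) Planting a transposition `c` at position `i − k` makes the
conjugate read `μ_n(i) c μ_n(i)⁻¹` at position `i`; eventual constancy for `c = (0 1), (1 2)` forces `μ_n(i)` eventually constant
(the centre of `S₃` is trivial — two facts about `S₃` checked by `decide`).  Hence `y ∈ ι(Q₀)`, `g = toHat(b, x)`, and `(b, x)`
normalises `H` by injectivity of `toHat`.

HONEST FRAMING. A DESIGNED consistency witness for OUR typed interface (`G_K = 1`; lamplighter groups, not
fundamental groups of curves): it decides which typed sentences are CONSEQUENCES of the interface and which are not;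
nothing of [EtTh] is asserted or denied for genuine tempered fundamental groups; instance-at-a-designed-carrier ≠ the
printed lemma; no side is taken on [IUTchIII] Cor. 3.12 or on any author; nothing here bears on abc. typed ≠ proved.
-/

noncomputable section

namespace Literature.AnabelianGeometry.EtaleTheta

namespace ThetaCovers

namespace LampModel

section Part_3b

open Multiplicative HeisenbergWitness Topology

/-! ## 1. Two facts about `S₃`, by computation -/

/-- The transposition `(0 1)` of `S₃` is not the identity. [folklore] -/
private theorem swap01_ne_one : (Equiv.swap (0 : Fin 3) 1) ≠ 1 := by decide

/-- An element of `S₃` is determined by its conjugation action on the transpositions `(0 1)`, `(1 2)` (the centre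
of `S₃` is trivial). [folklore] -/
private theorem perm_eq_of_conj_eq : ∀ a b : S,
    a * Equiv.swap (0 : Fin 3) 1 * a⁻¹ = b * Equiv.swap (0 : Fin 3) 1 * b⁻¹ →
    a * Equiv.swap (1 : Fin 3) 2 * a⁻¹ = b * Equiv.swap (1 : Fin 3) 2 * b⁻¹ → a = b := by
  decide

/-! ## 2. The combinatorial core -/

/-- **Core lemma, part (i) (the rotation part is an integer).** If conjugation by `(μ, a)` — `a` coherent — keeps
every test family (trivial below `N₀`, position-wise eventually constant) position-wise eventually constant, then
`a_n = k` for a single integer `k`. Otherwise `a` escapes every integer position for large `n`, and the family with the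
alternating lamp `μ_n(0)⁻¹ d_n μ_n(0)` planted at position `−a_n` is a test family whose conjugate reads `d_n` at
position `0` — not eventually constant. (toy bookkeeping) [cite: MochizukiEtTh2009, Lem 2.17(ii) p.58] -/
theorem core_int {N₀ : ℕ} (μ : ∀ n, F n) (a : ∀ n, ZMod (Nl n))
    (hcoh : ∀ {m n : ℕ}, m ≤ n → ∀ k : ℤ, a n = k → a m = k)
    (HY : ∀ m : ∀ n, F n, (∀ n, n < N₀ → m n = 1) → EvCF m → EvCF (conjF μ a m)) :
    ∃ k : ℤ, ∀ n, a n = k := by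
  classical
  by_contra hne
  push Not at hne
  -- for each `k`, `a_n ≠ k` for all large `n`
  have hev : ∀ k : ℤ, ∃ nk, ∀ n, nk ≤ n → a n ≠ k := fun k => by
    obtain ⟨nk, hnk⟩ := hne k
    exact ⟨nk, fun n hn h => hnk (hcoh hn k h)⟩
  -- the witness family
  let σ : S := Equiv.swap (0 : Fin 3) 1
  let d : ℕ → S := fun n => if Even n then σ else 1
  let m : ∀ n, F n := fun n j => if N₀ ≤ n ∧ j = -a n then (μ n 0)⁻¹ * d n * μ n 0 else 1
  have hm0 : ∀ n, n < N₀ → m n = 1 := fun n hn => by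
    funext j
    have hc : ¬ (N₀ ≤ n ∧ j = -a n) := fun h => (not_le.mpr hn) h.1
    simp only [m, if_neg hc]
    rfl
  have hmE : EvCF m := by
    intro i
    obtain ⟨nk, hnk⟩ := hev (-i)
    refine ⟨nk, 1, fun n hn => ?_⟩
    have : ¬ (N₀ ≤ n ∧ (i : ZMod (Nl n)) = -a n) := fun h => hnk n hn (by
      rw [Int.cast_neg, h.2, neg_neg])
    simp only [m, if_neg this]
  obtain ⟨N, c, hc⟩ := HY m hm0 hmE 0
  have hval : ∀ n, N₀ ≤ n → conjF μ a m n ((0 : ℤ) : ZMod (Nl n)) = d n := fun n hn => by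
    simp only [conjF, m, Int.cast_zero, zero_sub, and_true, if_pos hn]
    group
  have h1 := hc (2 * max N N₀) (le_trans (le_max_left _ _) (Nat.le_mul_of_pos_left _ two_pos))
  have h2 := hc (2 * max N N₀ + 1) (le_trans (le_max_left _ _)
    ((Nat.le_mul_of_pos_left _ two_pos).trans (Nat.le_succ _)))
  rw [hval _ (le_trans (le_max_right _ _) (Nat.le_mul_of_pos_left _ two_pos))] at h1
  rw [hval _ (le_trans (le_max_right _ _)
    ((Nat.le_mul_of_pos_left _ two_pos).trans (Nat.le_succ _)))] at h2
  have he : Even (2 * max N N₀) := even_two_mul _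
  have ho : ¬ Even (2 * max N N₀ + 1) := Nat.not_even_iff_odd.mpr (odd_two_mul_add_one _)
  simp only [d, if_pos he] at h1
  simp only [d, if_neg ho] at h2
  exact swap01_ne_one (h1.trans h2.symm)

/-- **Core lemma, part (ii) (the lamps converge).** If conjugation by `(μ, k)` with an INTEGER rotation part `k`
keeps the test families position-wise eventually constant, then `μ` is position-wise eventually constant: testing
with the transposition `c` planted at position `i − k` from level `N₀` on, the conjugate reads `μ_n(i) c μ_n(i)⁻¹`
at position `i`, which is eventually constant for `c = (0 1)` and `c = (1 2)` — hence so is `μ_n(i)`, the centre of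
`S₃` being trivial. (toy bookkeeping) [cite: MochizukiEtTh2009, Lem 2.17(ii) p.58] -/
theorem core_evCF {N₀ : ℕ} (μ : ∀ n, F n) (k : ℤ)
    (HY : ∀ m : ∀ n, F n, (∀ n, n < N₀ → m n = 1) → EvCF m →
      EvCF (conjF μ (fun n => (k : ZMod (Nl n))) m)) :
    EvCF μ := by
  classical
  intro i
  -- test families: `c` at position `i - k` from level `N₀` on
  let δ : S → ∀ n, F n := fun c n j => if N₀ ≤ n ∧ j = ((i - k : ℤ) : ZMod (Nl n)) then c else 1
  have hδ0 : ∀ c n, n < N₀ → δ c n = 1 := fun c n hn => by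
    funext j
    have hc : ¬ (N₀ ≤ n ∧ j = ((i - k : ℤ) : ZMod (Nl n))) := fun h => (not_le.mpr hn) h.1
    simp only [δ, if_neg hc]
    rfl
  have hδE : ∀ c, EvCF (δ c) := by
    intro c i'
    by_cases h : i' = i - k
    · refine ⟨N₀, c, fun n hn => ?_⟩
      simp only [δ, h, if_pos (And.intro hn rfl)]
    · obtain ⟨N, hN⟩ := eventually_cast_ne_zero (sub_ne_zero.mpr h)
      refine ⟨N, 1, fun n hn => ?_⟩
      have : ¬ (N₀ ≤ n ∧ (i' : ZMod (Nl n)) = ((i - k : ℤ) : ZMod (Nl n))) := fun h' =>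
        hN n hn (by rw [Int.cast_sub, h'.2, Int.cast_sub, sub_self])
      simp only [δ, if_neg this]
  have hval : ∀ c n, N₀ ≤ n → conjF μ (fun n => (k : ZMod (Nl n))) (δ c) n (i : ZMod (Nl n)) =
      μ n i * c * (μ n i)⁻¹ := fun c n hn => by
    simp only [conjF, δ, Int.cast_sub, and_true, if_pos hn]
  obtain ⟨N₁, e₁, h₁⟩ := HY (δ (Equiv.swap 0 1)) (hδ0 _) (hδE _) i
  obtain ⟨N₂, e₂, h₂⟩ := HY (δ (Equiv.swap 1 2)) (hδ0 _) (hδE _) i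
  let M := max (max N₁ N₂) N₀
  have hM0 : N₀ ≤ M := le_max_right _ _
  have hM1 : N₁ ≤ M := (le_max_left _ _).trans (le_max_left _ _)
  have hM2 : N₂ ≤ M := (le_max_right _ _).trans (le_max_left _ _)
  refine ⟨M, μ M i, fun n hn => perm_eq_of_conj_eq _ _ ?_ ?_⟩
  · rw [← hval _ n (hM0.trans hn), ← hval _ M hM0, h₁ n (hM1.trans hn), h₁ M hM1]
  · rw [← hval _ n (hM0.trans hn), ← hval _ M hM0, h₂ n (hM2.trans hn), h₂ M hM2]

/-! ## 3. Discrete normalisers in the model -/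

section Model

variable (l : ℕ)

/-- The conjugation formula at one level: `(y · (m, 1) · y⁻¹)_j = μ_j · m_{j − a} · μ_j⁻¹` for `y = (μ, a)`. (toy bookkeeping)
[cite: MochizukiEtTh2009, Lem 2.17(ii) p.58] -/
theorem conj_mk_left {n : ℕ} (y : W n) (m : F n) (j : ZMod (Nl n)) :
    (y * (⟨m, 1⟩ : W n) * y⁻¹).left j = y.left j * m (j - toAdd y.right) * (y.left j)⁻¹ := by
  simp only [SemidirectProduct.mul_left, SemidirectProduct.mul_right, SemidirectProduct.inv_left,
    Pi.mul_apply, rot_apply, Pi.inv_apply, mul_one, toAdd_inv, sub_neg_eq_add, sub_add_cancel]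

/-- The conjugate of a degree-`0` element of `Q̂` by `y ∈ Q̂` is the `conjF` family, levelwise. (toy bookkeeping)
[cite: MochizukiEtTh2009, Lem 2.17(ii) p.58] -/
theorem conj_mkQ_left (y : Qc) (m : ∀ n, F n) (n : ℕ) (j : ZMod (Nl n)) :
    (((y * mkQ m 0 * y⁻¹ : Qc) : Qfull) n).left j =
      conjF (fun n => ((y : Qfull) n).left) (fun n => toAdd ((y : Qfull) n).right) m n j := by
  have e : ((y * mkQ m 0 * y⁻¹ : Qc) : Qfull) n = (y : Qfull) n * ⟨m n, 1⟩ * ((y : Qfull) n)⁻¹ := by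
    rw [Subgroup.coe_mul, Subgroup.coe_mul, Subgroup.coe_inv, Pi.mul_apply, Pi.mul_apply,
      Pi.inv_apply, mkQ_zero_apply]
  rw [e, conj_mk_left]
  rfl

/-- **Key step.** An element `y ∈ Q̂` that conjugates every test element `(m, 0) ∈ Q₀` (trivial below level `N₀`,
degree `0`) into the image of `Q₀` lies itself in the image of `Q₀`: its rotation part is an integer (core (i)) and
its lamps converge (core (ii)). (toy bookkeeping) [cite: MochizukiEtTh2009, Lem 2.17(ii) p.58] -/
theorem exists_eq_ιQ_of_conj {N₀ : ℕ} (y : Qc)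
    (hy : ∀ m : ∀ n, F n, (∀ n, n < N₀ → m n = 1) → ∀ _ : EvCF m,
      ∃ x' : Qt, ιQ x' = y * mkQ m 0 * y⁻¹) :
    ∃ x : Qt, ιQ x = y := by
  let μ : ∀ n, F n := fun n => ((y : Qfull) n).left
  let a : ∀ n, ZMod (Nl n) := fun n => toAdd ((y : Qfull) n).right
  have HY : ∀ m : ∀ n, F n, (∀ n, n < N₀ → m n = 1) → EvCF m → EvCF (conjF μ a m) := by
    intro m hm0 hmE i
    obtain ⟨x', hx'⟩ := hy m hm0 hmE
    obtain ⟨N, c, hc⟩ := x'.2.2 i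
    refine ⟨N, c, fun n hn => ?_⟩
    have := hc n hn
    change ((((ιQ x' : Qc)) : Qfull) n).left (i : ZMod (Nl n)) = c at this
    rwa [hx', conj_mkQ_left] at this
  have hcoh : ∀ {m n : ℕ}, m ≤ n → ∀ k : ℤ, a n = k → a m = k := by
    intro m n hmn k hk
    have h := coh y hmn
    change ZMod.castHom _ _ (a n) = a m at h
    rw [← h, hk, map_intCast]
  obtain ⟨k, hk⟩ := core_int μ a hcoh HY
  have ha : a = fun n => (k : ZMod (Nl n)) := funext hk
  rw [ha] at HY
  have hμ : EvCF μ := core_evCF μ k HY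
  exact ⟨⟨(y, ofAdd k), ⟨fun n => by rw [toAdd_ofAdd]; exact hk n, hμ⟩⟩, rfl⟩

/-- **DISCRETE NORMALISERS IN THE MODEL** (the shape of [EtTh] Lemma 2.17 (ii)): for every OPEN subgroup
`H ⊆ Π^tp_C = A × Q₀` — of finite index or not — `N_{Π_C}(toHatL H) = toHatL(N_{Π^tp_C}(H))`. An element of the
normaliser conjugates the test elements of `H` into `toHatL(H) ⊆ toHatL(Π^tp_C)`, hence (key step) lies in `toHatL(Π^tp_C)`;
injectivity of `toHatL` does the rest. (toy bookkeeping) [cite: MochizukiEtTh2009, Lem 2.17(ii) p.58] -/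
theorem normalizer_map_toHatL (H : Subgroup (Gtp l)) (hH : IsOpen (H : Set (Gtp l))) :
    Subgroup.normalizer ((H.map (toHatL l) : Subgroup (P l)) : Set (P l)) =
      (Subgroup.normalizer (H : Set (Gtp l))).map (toHatL l) := by
  refine le_antisymm ?_ (Subgroup.le_normalizer_map _)
  rintro ⟨b, y⟩ hg
  obtain ⟨N₀, hN₀⟩ := exists_level_one_mem l H hH
  -- the `Q̂`-component of `g` lies in the image of `Q₀`
  have hy : ∀ m : ∀ n, F n, (∀ n, n < N₀ → m n = 1) → ∀ hm : EvCF m,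
      ∃ x' : Qt, ιQ x' = y * mkQ m 0 * y⁻¹ := by
    intro m hm0 hmE
    have hmem : ((1 : A l), mkQt m 0 hmE) ∈ H := by
      refine hN₀ _ (fun n hn => ?_) rfl
      rw [mkQt_fst, mkQ_zero_apply, hm0 n hn]
      rfl
    have h1 : toHatL l ((1 : A l), mkQt m 0 hmE) ∈ H.map (toHatL l) := Subgroup.mem_map_of_mem _ hmem
    have h2 := (Subgroup.mem_normalizer_iff.mp hg _).mp h1
    obtain ⟨⟨b', x'⟩, -, hx'⟩ := Subgroup.mem_map.mp h2
    exact ⟨x', congrArg Prod.snd hx'⟩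
  obtain ⟨x, hx⟩ := exists_eq_ιQ_of_conj y hy
  -- `g = toHatL (b, x)` and `(b, x)` normalises `H`
  have hgx : toHatL l (b, x) = (b, y) := by rw [toHatL_apply, hx]
  refine ⟨(b, x), ?_, hgx⟩
  change (b, x) ∈ Subgroup.normalizer (H : Set (Gtp l))
  rw [Subgroup.mem_normalizer_iff]
  intro h
  rw [← Subgroup.mem_map_iff_mem (toHatL_injective l), ← Subgroup.mem_map_iff_mem (toHatL_injective l)
    (K := H), map_mul, map_mul, map_inv, hgx]
  exact Subgroup.mem_normalizer_iff.mp hg _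

end Model

end Part_3b

end LampModel

end ThetaCovers

end Literature.AnabelianGeometry.EtaleTheta
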